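import Summits.RiemannHypothesis.RiemannHypothesis.Theorems.TiltedLandingLaw421R3FarStep

/-!
# BurgersRate — v2 ERRATA / ADD-ON (lens-2 `rh33346-lens-2-g0`, after crit-1 CUT 1 and critic g23's (G1)(G2) binders)

ns `RhW08.BurgersRate`; imports only `…R3FarStep`; restates NOTHING from the landed/landing helper (C′ 541fc8dc).

* B8 `drop_ge_newton_pushdown` (PROVED): from the tree's exact `RhW08.FarStep.drop_formula`, at an upper child `w` of a pair in a
  pushing-down far field (`Im K ≤ 0`): `(b² − y²)·‖K‖² ≥ y·(Re K)²/(y‖K‖² − Im K) + 2y|Im K|` — the level drop is AT LEAST the Newton drop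
  `cos²φ/(‖K‖²(1 + |Im K|/(y‖K‖²)))` PLUS the push-down bonus `2y|Im K|/‖K‖²`·‖K‖². With B7 (`charged_im_le`: the bonus is `< (s/4)(b+y)‖K‖²` on a
  charged level) and `realSources_grad_le` (`‖K′‖ ≤ |Im K|/y` for real foreign zeros) this is the DROP–GRADIENT COUPLING that bounds `Σ_j ε_j²`
  along a charged far chain by a universal constant (NODE v2 §3: `Σε² ≤ s/(4y*) + (κ²s²/8)·ln(y*/y_end) ≲ 0.05`, `y* = 2/(κ²s)`), answering the
  critic's addendum «saturation cannot persist across height bands».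
Models ≠ Ξ; RH is not proved.
-/

namespace RhW08.BurgersRate

open RhW08.IsolatedTilt RhW08.FarStep

/-- **B8 (PROVED)** drop ≥ Newton part + push-down bonus. Hypotheses: the critical relation of the upper child `w` (`pairQ a b w · K = −2(w − a)`),
`0 < Im w`, push-down `Im K ≤ 0`, `K ≠ 0`. -/
theorem drop_ge_newton_pushdown {w K : ℂ} {a b : ℝ} (h : pairQ a b w * K = -(2 * (w - a))) (hy : 0 < w.im)
    (hlam : K.im ≤ 0) (hK : K ≠ 0) :
    w.im * K.re ^ 2 / (w.im * Complex.normSq K - K.im) - 2 * w.im * K.im ≤ (b ^ 2 - w.im ^ 2) * Complex.normSq K := by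
  have hN : 0 < Complex.normSq K := Complex.normSq_pos.mpr hK
  have hD : 0 < w.im * Complex.normSq K - K.im := by nlinarith [mul_pos hy hN]
  have hdrop := drop_formula h
  -- ((b²−y²)N + 2yλ)·D² = y·Re² ·(yN − 2λ)
  have e : ((b ^ 2 - w.im ^ 2) * Complex.normSq K + 2 * w.im * K.im) * (w.im * Complex.normSq K - K.im) ^ 2 =
      w.im * K.re ^ 2 * (w.im * Complex.normSq K - 2 * K.im) := by
    linear_combination hdrop
  -- y·Re²·D ≤ y·Re²·(yN − 2λ)  since  D ≤ yN − 2λ  (λ ≤ 0)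
  have h1 : w.im * K.re ^ 2 * (w.im * Complex.normSq K - K.im) ≤ w.im * K.re ^ 2 * (w.im * Complex.normSq K - 2 * K.im) := by
    apply mul_le_mul_of_nonneg_left _ (by positivity)
    linarith
  have h2 : w.im * K.re ^ 2 * (w.im * Complex.normSq K - K.im) ≤
      ((b ^ 2 - w.im ^ 2) * Complex.normSq K + 2 * w.im * K.im) * (w.im * Complex.normSq K - K.im) ^ 2 := by
    rw [e]; exact h1
  have h3 : w.im * K.re ^ 2 ≤ ((b ^ 2 - w.im ^ 2) * Complex.normSq K + 2 * w.im * K.im) * (w.im * Complex.normSq K - K.im) := by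
    have h2' : w.im * K.re ^ 2 * (w.im * Complex.normSq K - K.im) ≤
        ((b ^ 2 - w.im ^ 2) * Complex.normSq K + 2 * w.im * K.im) * (w.im * Complex.normSq K - K.im) *
          (w.im * Complex.normSq K - K.im) := by
      simpa only [sq, mul_assoc] using h2
    exact le_of_mul_le_mul_right h2' hD
  rw [sub_le_iff_le_add, div_le_iff₀ hD]
  linarith

/-- **B8′ (PROVED, corollary)** the bare form used in the summation: drop ≥ push-down bonus and drop ≥ Newton part separately. -/
theorem drop_ge_pushdown_bonus {w K : ℂ} {a b : ℝ} (h : pairQ a b w * K = -(2 * (w - a))) (hy : 0 < w.im)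
    (hlam : K.im ≤ 0) (hK : K ≠ 0) :
    -(2 * w.im * K.im) ≤ (b ^ 2 - w.im ^ 2) * Complex.normSq K ∧
      w.im * K.re ^ 2 / (w.im * Complex.normSq K - K.im) ≤ (b ^ 2 - w.im ^ 2) * Complex.normSq K := by
  have hmain := drop_ge_newton_pushdown h hy hlam hK
  have hN : 0 < Complex.normSq K := Complex.normSq_pos.mpr hK
  have hD : 0 < w.im * Complex.normSq K - K.im := by nlinarith [mul_pos hy hN]
  have hpos : 0 ≤ w.im * K.re ^ 2 / (w.im * Complex.normSq K - K.im) := by positivity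
  constructor
  · nlinarith [mul_nonneg hy.le (neg_nonneg.mpr hlam)]
  · nlinarith [mul_nonneg hy.le (neg_nonneg.mpr hlam)]

end RhW08.BurgersRate
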